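import Summits.BirchSwinnertonDyer.Rank1Residual.X11a.BaseChangeRoute
import Mathlib.NumberTheory.LSeries.PrimesInAP
import HarnessLib

/-!
# Class X11a — the base-change input is a CONSEQUENCE of Mazur's main conjecture for `E` and
# its three twists (honesty check: the typed input is not vacuous and not stronger than MC ×4)
# (cell `b2b-bsdres`, unit `b2b-bsdres-x11a`, gen 23)

HONEST FRAMING (run/shared/lean/b2b/bsd-rank1-residual/, verbatim in every file): the goal of the
cell is to DELETE the COMBINATION-SHAPED residual classes of the Birch–Swinnerton-Dyer formula for
ALL analytic-rank `≤ 1` elliptic curves over `ℚ` — "full BSD formula for every rank `≤ 1` curve in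
class `C`" assembled STRICTLY from published theorems — so that the rank-`≤ 1` remainder becomes
exactly the CONSTRUCTION-SHAPED classes, which are TYPED (missing-input `Prop`s), NOT attempted.
This is not "finishing BSD". Research route; NO CLAIM BEYOND STATED CLASSES. Theorems only: no
definition, no new named fact; nothing is booked by this file and no label changes.

WHAT. `X11a/BaseChangeRoute.lean` (gen 23) typed the OPEN input `X11a.BaseChangeLowerBoundAt W p`
(the Burungale–Castella–Skinner display (5.3) at a multiplicative prime, integral) and proved that,
with Kato–Wuthrich for the four curves, it gives Mazur's main conjecture at `(E,p)` integrally.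
After the A86/A87 episode (a typed input that was false AS TYPED, making its consumers vacuous —
referee R121–R123), every new typed input of this lineage comes with a SANDWICH: this file proves
the other slice,
  **`baseChangeLowerBoundAt_of_mazurMainConjectureAt_twists`**: Mazur's main conjecture at `p`
  (`X2.MazurMainConjectureAt`, the tree's statement) for `W` AND for every globally minimal model
  of every quadratic twist `E^{(d)}`, `d ≠ 0`, implies `BaseChangeLowerBoundAt W p` (at any odd
  prime `p`; `W` globally minimal):
so the typed input lies BETWEEN "MC for `E` and three explicit twists" (which implies it, this file)
and "MC for `E`" (which it implies given A32 and surjectivity, `mazurMainConjectureAt_of_baseChangeLowerBound`)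
— it is a consequence of standard conjectures, hence consistent with them, and not vacuous. The
arithmetic half — the EXISTENCE of the fields of BCS Lemma 5.2.3 in the recorded shape (`d_K < 0`,
`d_F > 1`, `≡ 1 (mod 4)`, squarefree, `d_K ≠ -3`, coprime, prime to `pN`, `d_K` a square and
`d_F` a non-square mod `p`) — is the theorem `exists_baseChangeFields` (Dirichlet's theorem on
primes in progressions, Mathlib `Nat.forall_exists_prime_gt_and_zmodEq`, with the Chinese
remainder theorem mod `4p`: `d_F = ℓ` a prime `≡ 1 (4)` in a non-square class mod `p`,
`d_K = -ℓ'` with `ℓ'` a prime `≡ 3 (4)`, `≡ -1 (p)`, both larger than `pN`). The algebraic half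
is three lines: with `ch Xᵢ = (cᵢ)` and units `wᵢ` from the four main conjectures,
`G := ∏ T^{eᵢ} cᵢ wᵢ` has `ι G = ∏ ϖᵢ Lᵢ` and `∏ T^{eᵢ} ∏ cᵢ = G · ∏ wᵢ⁻¹ ∈ (G)`.

References: [BurungaleCastellaSkinner2025] Lemma 5.2.3, Prop. 5.2.1, display (5.3)
(arXiv:2405.00270v2 pp. 9–10); [Skinner2016PacificMC] Thm. A, §3.2–3.3 (shape of Mazur's statement);
HOME/b2b-bsdres-x11a/REPORT-g23.md.
-/

set_option autoImplicit false

noncomputable section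

open scoped Classical MatrixGroups ModularForm

open CongruenceSubgroup WeierstrassCurve Literature.NumberTheory.EllipticCurves
  Literature.NumberTheory.EllipticCurves.ModularForms
  Literature.NumberTheory.EllipticCurves.Rank1Residual

namespace Summit.BirchSwinnertonDyer.Rank1Residual.X11a

/-- **Mazur's statement in the uniform shape.** From `X2.MazurMainConjectureAt W p` at the data
`(κ, γ, f, D, ϖ)` and THE multiplicative function `L` (`IsTheMultPAdicLFunctionOf`): a generator
`c` of `ch X` and a unit `w` with `ι(T^e · c · w) = ϖ · L` (`T^e` = `trivialZeroFactor`).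
[cite: Skinner2016PacificMC, Thm. A with §3.2–3.3 (shape only)] -/
theorem mazurMainConjectureAt_trivialZeroFactor (W : WeierstrassCurve ℚ) [W.IsElliptic]
    [W.IsGloballyMinimal] (p : ℕ) [Fact p.Prime] (hMC : X2.MazurMainConjectureAt W p)
    {κ : ZpExtension ℚ p} {γ : Field.absoluteGaloisGroup ℚ} {N : ℕ} [NeZero N]
    {f : CuspForm (Gamma0 N) 2} (hκ : κ.IsCyclotomic) (hγ : κ.IsTopGenerator γ)
    (hγ' : IsCyclotomicVariable p γ) (hf : IsNewformOf W f) (D : W.SelmerDualData κ γ) (ϖ : ℚ)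
    (hϖ : (ϖ : ℝ) * W.realPeriodRat = plusPeriod f) (L : PowerSeries ℚ_[p])
    (hL : IsTheMultPAdicLFunctionOf W f p L) :
    ∃ (c : IwasawaAlgebra p) (w : (IwasawaAlgebra p)ˣ), D.charIdeal = Ideal.span {c} ∧
      iwasawaToPowerSeries p (trivialZeroFactor W p * c * (w : IwasawaAlgebra p)) =
        PowerSeries.C ((ϖ : ℚ) : ℚ_[p]) * L := by
  obtain ⟨-, c, hc, hsp, hns⟩ := hMC κ γ hκ hγ hγ' f hf D ϖ hϖ
  by_cases hs : W.HasSplitMultiplicativeReductionAtPrime p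
  · obtain ⟨w, hw⟩ := hsp hs L (hL.1 hs)
    exact ⟨c, w, hc, by rw [trivialZeroFactor_of_split W p hs]; exact hw⟩
  · obtain ⟨w, hw⟩ := hns hs L (hL.2 hs)
    exact ⟨c, w, hc, by rw [trivialZeroFactor_of_not_split W p hs, one_mul]; exact hw⟩

/-! ### The fields of BCS Lemma 5.2.3 exist (Dirichlet + CRT) -/

/-- A prime `ℓ > n` in a prescribed unit class mod `4p`: `ℓ ≡ r (mod 4)` and `ℓ ≡ s (mod p)` for
`r` odd and `p ∤ s`, `p` an odd prime (Chinese remainder theorem + Dirichlet's theorem on primes in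
arithmetic progressions, Mathlib `Nat.forall_exists_prime_gt_and_zmodEq`). [folklore] -/
theorem exists_prime_gt_modEq_four_and_modEq (p : ℕ) [Fact p.Prime] (hp2 : p ≠ 2) (n r s : ℕ)
    (hr : r % 2 = 1) (hs : ¬ p ∣ s) :
    ∃ ℓ : ℕ, n < ℓ ∧ ℓ.Prime ∧ ℓ ≡ r [MOD 4] ∧ ℓ ≡ s [MOD p] := by
  have hpP : p.Prime := Fact.out
  have hco : Nat.Coprime 4 p := by
    rw [show (4 : ℕ) = 2 ^ 2 by norm_num]
    exact (Nat.coprime_pow_left_iff (by norm_num) _ _).mpr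
      ((Nat.coprime_primes Nat.prime_two hpP).mpr (Ne.symm hp2))
  obtain ⟨k, hk4, hkp⟩ := Nat.chineseRemainder hco r s
  -- `k` is coprime to `4p`
  have hk4' : Nat.Coprime k 4 := by
    have h := hk4.gcd_eq
    rw [Nat.Coprime, h]
    have : Nat.gcd r 4 ∣ 4 := Nat.gcd_dvd_right r 4
    have hodd : ¬ 2 ∣ r := by omega
    have h2 : ¬ 2 ∣ Nat.gcd r 4 := fun h2 => hodd (h2.trans (Nat.gcd_dvd_left r 4))
    have hle : Nat.gcd r 4 ≤ 4 := Nat.le_of_dvd (by norm_num) this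
    interval_cases hg : Nat.gcd r 4 <;> simp_all
  have hkp' : Nat.Coprime k p := by
    have h := hkp.gcd_eq
    rw [Nat.Coprime, h]
    exact (Nat.coprime_comm.mp ((Nat.Prime.coprime_iff_not_dvd hpP).mpr hs))
  have hk : Nat.Coprime k (4 * p) := Nat.Coprime.mul_right hk4' hkp'
  have hkZ : IsCoprime (k : ℤ) ((4 * p : ℕ) : ℤ) := Nat.isCoprime_iff_coprime.mpr hk
  obtain ⟨ℓ, hℓn, hℓP, hℓ⟩ :=
    Nat.forall_exists_prime_gt_and_zmodEq n (q := 4 * p) (a := (k : ℤ))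
      (Nat.mul_ne_zero (by norm_num) hpP.ne_zero) hkZ
  have hℓN : ℓ ≡ k [MOD 4 * p] := Int.natCast_modEq_iff.mp (by exact_mod_cast hℓ)
  refine ⟨ℓ, hℓn, hℓP, ?_, ?_⟩
  · exact ((Nat.ModEq.of_mul_right p hℓN)).trans hk4
  · exact ((Nat.ModEq.of_mul_left 4 hℓN)).trans hkp

/-- **The fields of BCS Lemma 5.2.3 exist, in the recorded shape** (for an odd prime `p` and a
level `N ≠ 0`): integers `d_K < 0`, `d_F > 1`, squarefree, `≡ 1 (mod 4)`, `d_K ≠ -3`, coprime,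
`d_K d_F` prime to `pN`, `d_K` a square and `d_F` a non-square mod `p`. Construction: `d_F = ℓ` a
prime `> pN`, `ℓ ≡ 1 (4)`, `ℓ` in a non-square class mod `p` (one exists at odd `p`,
`FiniteField.exists_nonsquare`); `d_K = -ℓ'`, `ℓ'` a prime `> ℓ`, `ℓ' ≡ 3 (4)`, `ℓ' ≡ -1 (p)`.
[cite: BurungaleCastellaSkinner2025, Lemma 5.2.3 (arXiv:2405.00270v2 p. 10)] -/
theorem exists_baseChangeFields (p : ℕ) [Fact p.Prime] (hp2 : p ≠ 2) (N : ℕ) (hN : N ≠ 0) :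
    ∃ dK dF : ℤ,
      dK < 0 ∧ dK % 4 = 1 ∧ Squarefree dK ∧ dK ≠ -3 ∧
      1 < dF ∧ dF % 4 = 1 ∧ Squarefree dF ∧ IsCoprime dK dF ∧
      IsCoprime (dK * dF) (p * N) ∧
      IsSquare ((dK : ZMod p)) ∧ ¬ IsSquare ((dF : ZMod p)) := by
  have hpP : p.Prime := Fact.out
  have hp1 : 1 < p := hpP.one_lt
  -- a non-square class mod `p`
  obtain ⟨a0, ha0⟩ := FiniteField.exists_nonsquare (F := ZMod p) (by rw [ZMod.ringChar_zmod_n]; exact hp2)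
  have ha00 : a0 ≠ 0 := by rintro rfl; exact ha0 ⟨0, by simp⟩
  have hs : ¬ p ∣ a0.val := by
    intro h
    apply ha00
    have : (a0.val : ZMod p) = 0 := (ZMod.natCast_eq_zero_iff _ _).mpr h
    simpa [ZMod.natCast_zmod_val] using this
  -- `d_F = ℓ`
  obtain ⟨ℓ, hℓn, hℓP, hℓ4, hℓp⟩ :=
    exists_prime_gt_modEq_four_and_modEq p hp2 (p * N) 1 a0.val (by norm_num) hs
  -- `d_K = -ℓ'`, `ℓ' ≡ 3 (4)`, `ℓ' ≡ p - 1 (p)`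
  have hs' : ¬ p ∣ (p - 1) := by
    intro h
    have := Nat.le_of_dvd (by omega) h
    omega
  obtain ⟨ℓ', hℓ'n, hℓ'P, hℓ'4, hℓ'p⟩ :=
    exists_prime_gt_modEq_four_and_modEq p hp2 (ℓ + 3) 3 (p - 1) (by norm_num) hs'
  have hℓpos : 0 < ℓ := hℓP.pos
  have hℓ'pos : 0 < ℓ' := hℓ'P.pos
  have hℓℓ' : ℓ ≠ ℓ' := by omega
  have hpN : 0 < p * N := Nat.mul_pos hpP.pos (Nat.pos_of_ne_zero hN)
  -- divisibility facts: `ℓ, ℓ' ∤ p`, `∤ N`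
  have hℓ_not_p : ¬ ℓ ∣ p := fun h => by
    have := Nat.le_of_dvd hpP.pos h; nlinarith [Nat.pos_of_ne_zero hN]
  have hℓ_not_N : ¬ ℓ ∣ N := fun h => by
    have := Nat.le_of_dvd (Nat.pos_of_ne_zero hN) h; nlinarith
  have hℓ'_not_p : ¬ ℓ' ∣ p := fun h => by
    have := Nat.le_of_dvd hpP.pos h; nlinarith [Nat.pos_of_ne_zero hN]
  have hℓ'_not_N : ¬ ℓ' ∣ N := fun h => by
    have := Nat.le_of_dvd (Nat.pos_of_ne_zero hN) h; nlinarith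
  -- coprimality in `ℤ` from `ℕ`
  have cop : ∀ {a b : ℕ}, Nat.Coprime a b → IsCoprime (a : ℤ) (b : ℤ) :=
    fun h => Nat.isCoprime_iff_coprime.mpr h
  have hcℓp : Nat.Coprime ℓ p := (Nat.Prime.coprime_iff_not_dvd hℓP).mpr hℓ_not_p
  have hcℓN : Nat.Coprime ℓ N := (Nat.Prime.coprime_iff_not_dvd hℓP).mpr hℓ_not_N
  have hcℓ'p : Nat.Coprime ℓ' p := (Nat.Prime.coprime_iff_not_dvd hℓ'P).mpr hℓ'_not_p
  have hcℓ'N : Nat.Coprime ℓ' N := (Nat.Prime.coprime_iff_not_dvd hℓ'P).mpr hℓ'_not_N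
  have hcℓ'ℓ : Nat.Coprime ℓ' ℓ := (Nat.coprime_primes hℓ'P hℓP).mpr (Ne.symm hℓℓ')
  refine ⟨-(ℓ' : ℤ), (ℓ : ℤ), ?_, ?_, ?_, ?_, ?_, ?_, ?_, ?_, ?_, ?_, ?_⟩
  · -- `d_K < 0`
    have : (0 : ℤ) < ℓ' := by exact_mod_cast hℓ'pos
    linarith
  · -- `d_K % 4 = 1` from `ℓ' ≡ 3 (mod 4)`
    have h3 : (ℓ' : ℤ) % 4 = 3 := by
      have := hℓ'4; unfold Nat.ModEq at this; omega
    omega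
  · -- squarefree
    rw [← Int.squarefree_natAbs, Int.natAbs_neg, Int.natAbs_natCast]
    exact hℓ'P.prime.squarefree
  · -- `d_K ≠ -3`
    have : (3 : ℤ) < ℓ' := by exact_mod_cast (show 3 < ℓ' by omega)
    omega
  · exact_mod_cast hℓP.one_lt
  · have := hℓ4; unfold Nat.ModEq at this; omega
  · exact Int.squarefree_natCast.mpr hℓP.prime.squarefree
  · exact (cop hcℓ'ℓ).neg_left
  · -- `IsCoprime (d_K d_F) (p N)`
    have h1 : IsCoprime (-(ℓ' : ℤ)) ((p : ℤ) * N) :=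
      (IsCoprime.mul_right (cop hcℓ'p) (cop hcℓ'N)).neg_left
    have h2 : IsCoprime (ℓ : ℤ) ((p : ℤ) * N) := IsCoprime.mul_right (cop hcℓp) (cop hcℓN)
    exact IsCoprime.mul_left h1 h2
  · -- `d_K ≡ 1 (mod p)` is a square
    refine ⟨1, ?_⟩
    have h : ((ℓ' : ℕ) : ZMod p) = ((p - 1 : ℕ) : ZMod p) := (ZMod.natCast_eq_natCast_iff _ _ _).mpr hℓ'p
    have hp' : ((p - 1 : ℕ) : ZMod p) = -1 := by
      rw [Nat.cast_sub hp1.le, Nat.cast_one, ZMod.natCast_self, zero_sub]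
    push_cast
    rw [h, hp']
    ring
  · -- `d_F ≡ a0 (mod p)` is a non-square
    have h : ((ℓ : ℕ) : ZMod p) = ((a0.val : ℕ) : ZMod p) := (ZMod.natCast_eq_natCast_iff _ _ _).mpr hℓp
    rw [ZMod.natCast_zmod_val] at h
    intro hsq
    apply ha0
    have : ((ℓ : ℤ) : ZMod p) = a0 := by push_cast; exact h
    rwa [this] at hsq

/-! ### The converse: MC for `E` and its twists gives the display -/

/-- **Mazur's main conjecture for `E` and for its quadratic twists implies the base-change input.**
Let `W/ℚ` be globally minimal, `p` an odd prime, and assume `X2.MazurMainConjectureAt` (Mazur's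
statement at `p`, Néron-normalised, with the trivial zero) for `W` AND for every globally minimal
model `W'` of every quadratic twist `E^{(d)}`, `d ∈ ℤ ∖ {0}` (`∃ C, C • W' = W.quadraticTwist d`).
Then `BaseChangeLowerBoundAt W p` holds: the fields exist (`exists_baseChangeFields`), and for
any admissible data the element `G := ∏ᵢ T^{eᵢ} cᵢ wᵢ` (generators `cᵢ`, units `wᵢ` from the four
main conjectures) has `ι G = ∏ ϖᵢ Lᵢ` and `(∏ T^{eᵢ}) · ∏ ch Xᵢ = (∏ T^{eᵢ} cᵢ) ⊆ (G)`. So the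
typed input is implied by standard conjectures (not vacuous, not stronger than MC ×4).
[cite: BurungaleCastellaSkinner2025, display (5.3) and Lemma 5.2.3 (arXiv:2405.00270v2 p. 10)]
[cite: Skinner2016PacificMC, Thm. A with §3.2–3.3 (shape only)] -/
theorem baseChangeLowerBoundAt_of_mazurMainConjectureAt_twists (W : WeierstrassCurve ℚ)
    [W.IsElliptic] [W.IsGloballyMinimal] (p : ℕ) [Fact p.Prime] (hp2 : p ≠ 2)
    (hMC : X2.MazurMainConjectureAt W p)
    (hMCtw : ∀ (d : ℤ) (W' : WeierstrassCurve ℚ) [W'.IsElliptic] [W'.IsGloballyMinimal],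
      d ≠ 0 → (∃ C : VariableChange ℚ, C • W' = W.quadraticTwist (d : ℚ)) →
      X2.MazurMainConjectureAt W' p) :
    BaseChangeLowerBoundAt W p := by
  intro κ γ hκ hγ hγ' N _ f hf
  obtain ⟨dK, dF, hK0, hK4, hKsq, hK3, hF1, hF4, hFsq, hKF, hcop, hKres, hFres⟩ :=
    exists_baseChangeFields p hp2 N (NeZero.ne N)
  refine ⟨dK, dF, hK0, hK4, hKsq, hK3, hF1, hF4, hFsq, hKF, hcop, hKres, hFres, ?_⟩
  intro W₁ W₂ W₃ _ _ _ _ _ _ h₁ h₂ h₃ N₁ N₂ N₃ _ _ _ f₁ f₂ f₃ hf₁ hf₂ hf₃ D D₁ D₂ D₃ ϖ ϖ₁ ϖ₂ ϖ₃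
    hϖ hϖ₁ hϖ₂ hϖ₃ L L₁ L₂ L₃ hL hL₁ hL₂ hL₃
  have hF0 : dF ≠ 0 := by omega
  have hKF0 : dK * dF ≠ 0 := mul_ne_zero hK0.ne hF0
  obtain ⟨c₀, w₀, hc₀, hι₀⟩ :=
    mazurMainConjectureAt_trivialZeroFactor W p hMC hκ hγ hγ' hf D ϖ hϖ L hL
  obtain ⟨c₁, w₁, hc₁, hι₁⟩ := mazurMainConjectureAt_trivialZeroFactor W₁ p
    (hMCtw dK W₁ hK0.ne h₁) hκ hγ hγ' hf₁ D₁ ϖ₁ hϖ₁ L₁ hL₁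
  obtain ⟨c₂, w₂, hc₂, hι₂⟩ := mazurMainConjectureAt_trivialZeroFactor W₂ p
    (hMCtw dF W₂ hF0 h₂) hκ hγ hγ' hf₂ D₂ ϖ₂ hϖ₂ L₂ hL₂
  obtain ⟨c₃, w₃, hc₃, hι₃⟩ := mazurMainConjectureAt_trivialZeroFactor W₃ p
    (hMCtw (dK * dF) W₃ hKF0 h₃) hκ hγ hγ' hf₃ D₃ ϖ₃ hϖ₃ L₃ hL₃
  set t₀ := trivialZeroFactor W p
  set t₁ := trivialZeroFactor W₁ p
  set t₂ := trivialZeroFactor W₂ p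
  set t₃ := trivialZeroFactor W₃ p
  refine ⟨t₀ * c₀ * w₀ * (t₁ * c₁ * w₁) * (t₂ * c₂ * w₂) * (t₃ * c₃ * w₃), ?_, ?_⟩
  · rw [map_mul, map_mul, map_mul, hι₀, hι₁, hι₂, hι₃]
    push_cast
    simp only [map_mul]
    ring
  · rw [hc₀, hc₁, hc₂, hc₃, Ideal.span_singleton_mul_span_singleton,
      Ideal.span_singleton_mul_span_singleton, Ideal.span_singleton_mul_span_singleton,
      Ideal.span_singleton_mul_span_singleton, Ideal.span_singleton_le_iff_mem,
      Ideal.mem_span_singleton']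
    set u₀ : IwasawaAlgebra p := ((w₀⁻¹ : (IwasawaAlgebra p)ˣ) : IwasawaAlgebra p) with hu₀
    set u₁ : IwasawaAlgebra p := ((w₁⁻¹ : (IwasawaAlgebra p)ˣ) : IwasawaAlgebra p) with hu₁
    set u₂ : IwasawaAlgebra p := ((w₂⁻¹ : (IwasawaAlgebra p)ˣ) : IwasawaAlgebra p) with hu₂
    set u₃ : IwasawaAlgebra p := ((w₃⁻¹ : (IwasawaAlgebra p)ˣ) : IwasawaAlgebra p) with hu₃
    have h0 : u₀ * (w₀ : IwasawaAlgebra p) = 1 := w₀.inv_mul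
    have h1 : u₁ * (w₁ : IwasawaAlgebra p) = 1 := w₁.inv_mul
    have h2 : u₂ * (w₂ : IwasawaAlgebra p) = 1 := w₂.inv_mul
    have h3 : u₃ * (w₃ : IwasawaAlgebra p) = 1 := w₃.inv_mul
    refine ⟨u₀ * u₁ * u₂ * u₃, ?_⟩
    linear_combination (t₀ * c₀ * (t₁ * c₁) * (t₂ * c₂) * (t₃ * c₃)) *
      ((u₁ * (w₁ : IwasawaAlgebra p)) * (u₂ * (w₂ : IwasawaAlgebra p)) *
          (u₃ * (w₃ : IwasawaAlgebra p)) * h0 +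
        (u₂ * (w₂ : IwasawaAlgebra p)) * (u₃ * (w₃ : IwasawaAlgebra p)) * h1 +
        (u₃ * (w₃ : IwasawaAlgebra p)) * h2 + h3)

end Summit.BirchSwinnertonDyer.Rank1Residual.X11a

end
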